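import Mathlib
import Summits.Ventures.DiscreteObjects.Mahler.CensusResultantCutsVerdict
import Summits.Ventures.DiscreteObjects.Mahler.CensusAuxiliaryLog

/-!
# Census verdicts with Toeplitz, resultant AND auxiliary-function cuts (venture `DiscreteObjects`, target L)

Cell `pub-namedobj`, seat `pub-namedobj-mahler-g15`. Framing: lottery ticket; floor = certified bounds/negative
ranges.

Extension of `CensusResultantCutsVerdict` (mixed Toeplitz/resultant cut tables, seat g14) by a third kind of cut: the
explicit-auxiliary-function cuts `CutValidAL` of `CensusAuxiliaryLog` (each proved separately from a kernel-checked two-circle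
certificate, `CensusAuxCertificate.cutValidAL_of_claims`).  A cut of the combined table is valid if it is valid in either
sense (`CutValidX`); the table is assembled depth by depth from a `decide`-checked mixed table and a table of certified
auxiliary cuts (`mergeTables`, `cutTableValidX_merge`).  The kernel search `censusSearchC T CT` and the certificate checker
are unchanged (mahler g12/g13), so soundness and the verdicts go through verbatim for irreducible polynomials:
`take_descCoeffList_mem_censusSearchC_of_irreducibleX`, `census_verdict_nonnegX`, `degreeCensus_of_certified_nonnegX`.
-/

namespace Summit.Ventures.DiscreteObjects.Mahler

open Polynomial

/-! ## Combined validity -/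

/-- A cut is valid if it is a valid Toeplitz/resultant cut or a valid auxiliary-function cut. -/
def CutValidX (d k : ℕ) (B : ℝ) (c : List ℤ × ℤ) : Prop := CutValidTR d k B c ∨ CutValidAL d k B c

/-- Every cut of the table at every depth `1 ≤ k ≤ d` is valid. -/
def CutTableValidX (d : ℕ) (B : ℝ) (CT : List (List (List ℤ × ℤ))) : Prop :=
  ∀ k, 1 ≤ k → k ≤ d → ∀ c ∈ CT.getD (k - 1) [], CutValidX d k B c

/-- The table of certified auxiliary cuts is valid (each entry proved separately). -/
def CutTableValidAL (d : ℕ) (B : ℝ) (CT : List (List (List ℤ × ℤ))) : Prop :=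
  ∀ k, 1 ≤ k → k ≤ d → ∀ c ∈ CT.getD (k - 1) [], CutValidAL d k B c

/-- Depth-wise concatenation of two cut tables (padding with the longer tail). -/
def mergeTables : List (List (List ℤ × ℤ)) → List (List (List ℤ × ℤ)) → List (List (List ℤ × ℤ))
  | [], M => M
  | L, [] => L
  | l :: L, m :: M => (l ++ m) :: mergeTables L M

/-- Entries of the merged table come from one of the two tables (same depth). -/
theorem mem_mergeTables_getD : ∀ (L M : List (List (List ℤ × ℤ))) (i : ℕ) (c : List ℤ × ℤ),
    c ∈ (mergeTables L M).getD i [] → c ∈ L.getD i [] ∨ c ∈ M.getD i []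
  | [], M, i, c, h => Or.inr (by simpa [mergeTables] using h)
  | l :: L, [], i, c, h => Or.inl (by simpa [mergeTables] using h)
  | l :: L, m :: M, i, c, h => by
    cases i with
    | zero =>
      simp only [mergeTables, List.getD_cons_zero, List.mem_append] at h
      simpa using h
    | succ i =>
      simp only [mergeTables, List.getD_cons_succ] at h ⊢
      exact mem_mergeTables_getD L M i c h

/-- **Merging a valid mixed table with a valid auxiliary table gives a valid combined table.** -/
theorem cutTableValidX_merge {d : ℕ} {B : ℝ} {CTR CAL : List (List (List ℤ × ℤ))} (hTR : CutTableValidTR d B CTR)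
    (hAL : CutTableValidAL d B CAL) : CutTableValidX d B (mergeTables CTR CAL) := by
  intro k hk1 hk2 c hc
  rcases mem_mergeTables_getD CTR CAL (k - 1) c hc with h | h
  · exact Or.inl (hTR k hk1 hk2 c h)
  · exact Or.inr (hAL k hk1 hk2 c h)

/-! ## Soundness of the search with a combined table, for irreducible polynomials -/

/-- The cuts of a valid combined table hold for a monic IRREDUCIBLE palindromic `p` of degree `2d` with `M(p) < B`. -/
theorem cutX_holds {p : ℤ[X]} {d : ℕ} (hmonic : p.Monic) (hirr : Irreducible p) (hdeg : p.natDegree = 2 * d)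
    (hpal : ∀ j ≤ 2 * d, p.coeff j = p.coeff (2 * d - j)) {B : ℝ} (hB : intMahlerMeasure p < B) {k : ℕ}
    {c : List ℤ × ℤ} (hc : CutValidX d k B c) :
    0 ≤ c.2 + (List.zipWith (· * ·) c.1 (psumsRev (descCoeffList p) k)).sum :=
  hc.elim (fun h => cutTR_holds hmonic hirr hdeg hpal hB h) (fun h => acutLog_holds hmonic hirr hdeg hpal hB h)

/-- **Soundness of the search with a combined table.** A monic irreducible palindromic `p ∈ ℤ[X]` of degree `2d ≥ 2` with
`M(p) < B` has its half coefficient vector in `censusSearchC T CT d [] []`, for valid thresholds (`|T| ≥ d`) and a valid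
combined cut table. -/
theorem take_descCoeffList_mem_censusSearchC_of_irreducibleX {p : ℤ[X]} {d : ℕ} (hd : 1 ≤ d) (hmonic : p.Monic)
    (hirr : Irreducible p) (hdeg : p.natDegree = 2 * d) (hpal : ∀ j ≤ 2 * d, p.coeff j = p.coeff (2 * d - j)) {B : ℝ}
    (hB : intMahlerMeasure p < B) {T : List ℕ} (hdT : d ≤ T.length) (hT : ThresholdsValid d B T)
    {CT : List (List (List ℤ × ℤ))} (hCT : CutTableValidX d B CT) :
    (descCoeffList p).take d ∈ censusSearchC T CT d [] [] := by
  apply mem_censusSearchC hdT _ (by rw [List.length_take, length_descCoeffList, hdeg]; omega)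
  · intro k hk1 hk2
    rw [palC_take_descCoeffList hd hmonic hdeg hpal]
    have hP := rec_even_powerSum_test p d hd hmonic hdeg hpal hB (k := k) (by omega)
    rw [← rootPowerSum_def, rootPowerSum_eq_head hmonic hk1, Complex.norm_intCast] at hP
    have hTk := hT k hk1 hk2
    set N := (psumsRev (descCoeffList p) k).getD 0 0
    have h1 : (|N| : ℝ) < (T.getD (k - 1) 0 : ℝ) + 1 := lt_of_lt_of_le hP hTk
    have h2 : |N| < (T.getD (k - 1) 0 : ℤ) + 1 := by exact_mod_cast h1
    have h3 : (N.natAbs : ℤ) ≤ (T.getD (k - 1) 0 : ℤ) := by rw [Int.natCast_natAbs]; omega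
    exact_mod_cast h3
  · intro k hk1 hk2 c hc
    rw [palC_take_descCoeffList hd hmonic hdeg hpal]
    exact cutX_holds hmonic hirr hdeg hpal hB (hCT k hk1 hk2 c hc)

/-! ## Verdicts (certificates for `c₁ ≥ 0` only) -/

/-- **Census verdict from certificates for `c₁ ≥ 0` only (search with a combined cut table).** -/
theorem census_verdict_nonnegX {Bn Bd d : ℕ} {T : List ℕ} {CT : List (List (List ℤ × ℤ))} {L : List (List ℤ)}
    (hBd : 0 < Bd) (hd : 1 ≤ d) (hdT : d ≤ T.length) (hT : ThresholdsValid d ((Bn : ℝ) / Bd) T)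
    (hCT : CutTableValidX d ((Bn : ℝ) / Bd) CT)
    (hcert : ∀ a ∈ censusSearchC T CT d [] [], 0 ≤ a.getD 0 0 →
      ∃ c, checkCert Bn Bd (2 * d) L (1 :: palC a) c = true)
    {p : ℤ[X]} (hmonic : p.Monic) (hdeg : p.natDegree = 2 * d)
    (hpal : ∀ j ≤ 2 * d, p.coeff j = p.coeff (2 * d - j)) (hirr : Irreducible p)
    (h1 : 1 < intMahlerMeasure p) (hB : intMahlerMeasure p < (Bn : ℝ) / Bd) :
    ∃ l ∈ L, p = ofCoeffs l ∨ p = (ofCoeffs l).comp (-X) := by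
  have key : ∀ q : ℤ[X], q.Monic → q.natDegree = 2 * d → (∀ j ≤ 2 * d, q.coeff j = q.coeff (2 * d - j)) →
      Irreducible q → 1 < intMahlerMeasure q → intMahlerMeasure q < (Bn : ℝ) / Bd → 0 ≤ q.coeff (2 * d - 1) →
      ∃ l ∈ L, q = ofCoeffs l ∨ q = (ofCoeffs l).comp (-X) := by
    intro q hqm hqd hqp hqi hq1 hqB hq0
    have hmem := take_descCoeffList_mem_censusSearchC_of_irreducibleX hd hqm hqi hqd hqp hqB hdT hT hCT
    obtain ⟨c, hc⟩ := hcert _ hmem (by rw [getD_zero_take_descCoeffList hd hqd]; exact hq0)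
    rw [palC_take_descCoeffList hd hqm hqd hqp] at hc
    have hp := eq_ofCoeffs_descCoeffList hqm hqd hqp
    have hmon' : (ofCoeffs (1 :: descCoeffList q)).Monic := by rw [← hp]; exact hqm
    have hdeg' : (ofCoeffs (1 :: descCoeffList q)).natDegree = 2 * d := by rw [← hp]; exact hqd
    have hs := checkCert_sound hBd hc hmon' hdeg'
    rw [← hp] at hs
    rcases hs with h | h | h | h
    · rw [h] at hq1; exact absurd hq1 (lt_irrefl _)
    · exact absurd hqi h
    · exact absurd hqB (not_lt.mpr h.le)
    · exact h
  by_cases h0 : 0 ≤ p.coeff (2 * d - 1)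
  · exact key p hmonic hdeg hpal hirr h1 hB h0
  · push Not at h0
    obtain ⟨hqm, hqd, hqp, hqc⟩ := comp_neg_X_palindromic hd hmonic hdeg hpal
    have hq := key (p.comp (-X)) hqm hqd hqp (irreducible_comp_neg_X hirr)
      (by rw [intMahlerMeasure_comp_neg_X]; exact h1) (by rw [intMahlerMeasure_comp_neg_X]; exact hB)
      (by rw [hqc]; omega)
    obtain ⟨l, hl, h⟩ := hq
    refine ⟨l, hl, ?_⟩
    rcases h with h | h
    · right; rw [← h, comp_neg_X_comp_neg_X]
    · left
      have := congrArg (fun r : ℤ[X] => r.comp (-X)) h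
      simpa only [comp_neg_X_comp_neg_X] using this

/-- **From the halved kernel check (search with a combined cut table) to a census row** (`B = Bn/Bd ≤ θ₀`). -/
theorem degreeCensus_of_certified_nonnegX {Bn Bd d : ℕ} {T : List ℕ} {CT : List (List (List ℤ × ℤ))}
    {L : List (List ℤ)} (hBd : 0 < Bd) (hd : 1 ≤ d) (hdT : d ≤ T.length) (hT : ThresholdsValid d ((Bn : ℝ) / Bd) T)
    (hCT : CutTableValidX d ((Bn : ℝ) / Bd) CT) (hθ : (Bn : ℝ) / Bd ≤ smythTheta)
    (hcert : ∀ a ∈ censusSearchC T CT d [] [], 0 ≤ a.getD 0 0 →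
      ∃ c, checkCert Bn Bd (2 * d) L (1 :: palC a) c = true) :
    DegreeCensus (2 * d) ((Bn : ℝ) / Bd) L := by
  intro p hdeg hirr h1 h2
  have hrev := (reciprocal_of_measure_lt_smythTheta hirr h1 (lt_of_lt_of_le h2 hθ)).1
  have hlc : (|p.leadingCoeff| : ℝ) ≤ intMahlerMeasure p := abs_leadingCoeff_le_intMahlerMeasure p
  have hθ2 : smythTheta < 2 := by have := smythTheta_lt; linarith
  have hlc1 : p.leadingCoeff = 1 ∨ p.leadingCoeff = -1 := by
    have hne : p.leadingCoeff ≠ 0 := leadingCoeff_ne_zero.mpr hirr.ne_zero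
    have hle : |p.leadingCoeff| ≤ 1 := by
      by_contra h
      push Not at h
      have : (2 : ℝ) ≤ (|p.leadingCoeff| : ℝ) := by
        have : (2 : ℤ) ≤ |p.leadingCoeff| := h
        exact_mod_cast this
      linarith
    rcases abs_le.mp hle with ⟨h1', h2'⟩
    omega
  obtain ⟨hmonic, hpm, hMm, hdegm, hirrm⟩ := monic_normalisation hlc1
  set q := C p.leadingCoeff * p with hq
  have hrevq : q.reverse = q := by rw [hq, reverse_mul_of_domain, reverse_C, hrev]
  rw [hdeg] at hdegm
  have hpal := palindromic_of_reverse_eq_self q (2 * d) hdegm hrevq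
  rw [← hMm] at h1 h2
  obtain ⟨l, hl, hql⟩ := census_verdict_nonnegX hBd hd hdT hT hCT hcert hmonic hdegm hpal (hirrm hirr) h1 h2
  refine ⟨l, hl, ?_⟩
  rcases hlc1 with hc | hc
  · have hpq : p = q := by rw [hpm, hc, C_1, one_mul]
    rcases hql with h | h
    · exact Or.inl (hpq.trans h)
    · exact Or.inr (Or.inr (Or.inl (hpq.trans h)))
  · have hpq : p = -q := by
      conv_lhs => rw [hpm, hc]
      simp
    rcases hql with h | h
    · exact Or.inr (Or.inl (by rw [hpq, h]))
    · exact Or.inr (Or.inr (Or.inr (by rw [hpq, h])))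

/-- The census bound `13/10` as a rational cast (to use certificates stated with `((13/10 : ℚ) : ℝ)`). -/
theorem ratCast_thirteen_tenths : (((13 / 10 : ℚ)) : ℝ) = ((13 : ℕ) : ℝ) / ((10 : ℕ) : ℝ) := by
  push_cast; norm_num

end Summit.Ventures.DiscreteObjects.Mahler
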